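import Summits.BirchSwinnertonDyer.BirchSwinnertonDyer.Theorems.ManinLocalTwoThreePinningKernelRows
import HarnessLib

/-!
# Pinning rows on an EXTENDED basis: the padded-row bridge

Cell `bsd-f2-manin`, route `ManinLocalTwoThree`, crux C2 `ManinOddAtFour` (stmt-BirchSwinnertonDyer-22967) / C3 (stmt-…-22968); prover seat p2 gen 32 (`--supports`, helper).
The `S₂ → M₂` basis-completion device (levels pinned by the kernel in `S₂(Γ₀(N))` on a CUSPIDAL `η`-basis `C : Fin K`, Bracket–Sturm certificates whose
`x∘φ = A/B` needs a basis `E : Fin K'` of `M₂(Γ₀(N))` extending it, `E i = C i` for `i < K`): the pinning identity `d′ • f = Σ_{j<K} y_j • C_j` is the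
same identity on `E` with `y` padded by zeros.  One generic lemma, **`sum_extend_zero`**, consumed by the level capstones (`168`, `224`, …).
Pure linear-algebra bookkeeping (standard axioms); nothing here proves C2/C3, Manin's conjecture or BSD.
[cite: DiamondShurman2005, Thm. 3.5.1]
-/

set_option autoImplicit false
-- lint-debt: the directory name repeats the summit name (sibling precedent `ManinLocalTwoThreePinningKernelRows.lean`)
set_option linter.dupNamespace false

open scoped BigOperators

namespace Summit.BirchSwinnertonDyer.BirchSwinnertonDyer.Theorems.ManinLocalTwoThree.PinningKernel

/-- **Padded-row bridge** (generic bookkeeping): a pinning identity on a family `C : Fin K → V` is the same identity on any extension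
`E : Fin K' → V` (`E i = C i` for `i < K`) with the coordinate list padded by zeros. [folklore] -/
theorem sum_extend_zero {V : Type*} [AddCommGroup V] [Module ℂ V] {K K' : ℕ} (hKK' : K ≤ K') (C : Fin K → V) (E : Fin K' → V)
    (hCE : ∀ i : Fin K', (h : (i : ℕ) < K) → E i = C ⟨i, h⟩) (y y' : List ℤ)
    (hy : ∀ n < K, y'.getD n 0 = y.getD n 0) (hy' : ∀ n < K', K ≤ n → y'.getD n 0 = 0) :
    ∑ i : Fin K', ((y'.getD (i : ℕ) 0 : ℤ) : ℂ) • E i = ∑ j : Fin K, ((y.getD (j : ℕ) 0 : ℤ) : ℂ) • C j := by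
  set f : ℕ → V := fun n ↦ if h : n < K' then ((y'.getD n 0 : ℤ) : ℂ) • E ⟨n, h⟩ else 0 with hf
  set g : ℕ → V := fun n ↦ if h : n < K then ((y.getD n 0 : ℤ) : ℂ) • C ⟨n, h⟩ else 0 with hg
  have h1 : ∑ i : Fin K', ((y'.getD (i : ℕ) 0 : ℤ) : ℂ) • E i = ∑ n ∈ Finset.range K', f n := by
    rw [← Fin.sum_univ_eq_sum_range]
    refine Finset.sum_congr rfl fun i _ ↦ ?_
    rw [hf]; simp only [dif_pos i.isLt, Fin.eta]
  have h2 : ∑ j : Fin K, ((y.getD (j : ℕ) 0 : ℤ) : ℂ) • C j = ∑ n ∈ Finset.range K, g n := by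
    rw [← Fin.sum_univ_eq_sum_range]
    refine Finset.sum_congr rfl fun j _ ↦ ?_
    rw [hg]; simp only [dif_pos j.isLt, Fin.eta]
  rw [h1, h2, Finset.range_eq_Ico, Finset.range_eq_Ico, ← Finset.sum_Ico_consecutive f (Nat.zero_le K) hKK']
  have h3 : ∑ n ∈ Finset.Ico K K', f n = 0 := by
    refine Finset.sum_eq_zero fun n hn ↦ ?_
    rw [Finset.mem_Ico] at hn
    rw [hf]; simp only
    rw [dif_pos hn.2, hy' n hn.2 hn.1]; simp
  rw [h3, add_zero]
  refine Finset.sum_congr rfl fun n hn ↦ ?_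
  rw [Finset.mem_Ico] at hn
  rw [hf, hg]; simp only
  rw [dif_pos (lt_of_lt_of_le hn.2 hKK'), dif_pos hn.2, hCE ⟨n, lt_of_lt_of_le hn.2 hKK'⟩ hn.2, hy n hn.2]


end Summit.BirchSwinnertonDyer.BirchSwinnertonDyer.Theorems.ManinLocalTwoThree.PinningKernel
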